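import Mathlib
import Literature.NumberTheory.Sieve.Maynard2016CoupledProduct
import Literature.NumberTheory.Sieve.Maynard2016CoupledLocalW
import Literature.NumberTheory.Sieve.Maynard2016CoupledKernelWLimit
import HarnessLib

/-!
# Maynard (2016), Lemma 7, display (6.32): the weighted coupled kernel against `ζ`

Topic `Literature/NumberTheory/Sieve`; trunk AntSieve / parity (Maynard 2016 large-gaps ladder, named
fact `Literature.NumberTheory.Sieve.Maynard2016.Lemma7Tuple` of `Maynard2016Lemma7PerTuple.lean`).

J. Maynard, *Large gaps between primes*, Ann. of Math. (2) 183 (2016), 915–933 = arXiv:1408.5110,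
§6: (6.11)–(6.16) and Lemma 7 (6.32) ("following the argument of Lemma 6 we obtain (6.32)").  Port of
`Maynard2016CoupledProduct` to the weighted kernel `coupledKernelW w` (`IsLcmWeight w`, e.g. `1/φ`):
with the constants `goodConstW = goodConst + 2(3k+3k'+9kk')`, `badConstW = badConst + 2(3k+3k'+9kk')`
(the extra `O(1/p²)` of `Maynard2016CoupledLocalW.norm_coupledEpsW_sub_coupledEps_le`) the whole file
goes through verbatim: `E^w = ∏_{p ∤ W}(1 + η^w_p)` converges absolutely with
`‖E^w‖ ≤ exp(T^w)`, `‖E^w − 1‖ ≤ exp(T^w) − 1`, and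
**`K^w = E^w · N · Z(s,s') · Z(r,r')`** (`coupledKernelW_eq_prod`) with the SAME arithmetic factor
`N = nuProd` and the same `ζ_W`-products as Lemma 6.

## References

* J. Maynard, *Large gaps between primes*, Ann. of Math. (2) 183 (2016), 915–933; arXiv:1408.5110,
  §6, (6.11)–(6.16) and (6.32). [Maynard2016LargeGaps]
-/

noncomputable section

open Filter Finset
open scoped BigOperators Topology Classical

namespace Literature.NumberTheory.Sieve

namespace LcmEuler

variable {ι κ : Type*} [Fintype ι] [Fintype κ]

/-! ### The constants of the weighted local estimates -/

omit [Fintype ι] [Fintype κ] in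
/-- `C^w₁ = C₁ + 2(3k + 3k' + 9kk')`. [cite: Maynard2016LargeGaps, §6 displays (6.12), (6.32)] -/
def goodConstW (k k' : ℕ) : ℝ := goodConst k k' + 2 * (3 * k + 3 * k' + 9 * k * k')

omit [Fintype ι] [Fintype κ] in
/-- `C^w₂ = C₂ + 2(3k + 3k' + 9kk')`. [cite: Maynard2016LargeGaps, §6 displays (6.13), (6.32)] -/
def badConstW (k k' : ℕ) : ℝ := badConst k k' + 2 * (3 * k + 3 * k' + 9 * k * k')

omit [Fintype ι] [Fintype κ] in
/-- `C^w₂ ≥ 0`. [cite: Maynard2016LargeGaps, §6 display (6.13)] -/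
theorem badConstW_nonneg (k k' : ℕ) : 0 ≤ badConstW k k' := by
  unfold badConstW; have := badConst_nonneg k k'; positivity

omit [Fintype ι] [Fintype κ] in
/-- `C^w₁ ≤ C^w₂`. [cite: Maynard2016LargeGaps, §6 displays (6.12)–(6.13)] -/
theorem goodConstW_le_badConstW (k k' : ℕ) : goodConstW k k' ≤ badConstW k k' := by
  have h : (0 : ℝ) ≤ 12 * (k' : ℝ) ^ 2 + 8 * (49 * (k' : ℝ) ^ 2 + 8 * k') +
      k * k' * (6 * k + 3 * k' + 2 * (49 * (k : ℝ) ^ 2 + 8 * k) + 4 * (49 * (k' : ℝ) ^ 2 + 8 * k')) := by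
    positivity
  unfold goodConstW badConstW badConst; linarith

/-- `|η^w_p| ≤ 6^{k+k'} (C^w₂/p² + 16(k'+kk') τ log p/p)` (the shape of `norm_coupledEps_le`).
[cite: Maynard2016LargeGaps, §6 displays (6.13), (6.32)] -/
theorem norm_coupledEpsW_le' {w : ℕ → ℂ} (hw : IsLcmWeight w) {m : ℕ} {M : ℕ → Finset (ι × κ)}
    {a b : ι → ℂ} {a' b' : κ → ℂ} (hab : ∀ i, 0 ≤ (a i).re ∧ 0 ≤ (b i).re)
    (hab' : ∀ j, 0 ≤ (a' j).re ∧ 0 ≤ (b' j).re) {q : ℕ} (hq : q.Prime)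
    (hqk : 7 * Fintype.card ι ≤ q) (hqk' : 7 * Fintype.card κ ≤ q) {τ : ℝ} (hτ0 : 0 ≤ τ)
    (ha : ∀ i, ‖a i‖ ≤ τ) (ha' : ∀ j, ‖a' j‖ ≤ τ) :
    ‖coupledEpsW w m M a b a' b' q‖ ≤
      6 ^ (Fintype.card ι + Fintype.card κ) *
        (badConstW (Fintype.card ι) (Fintype.card κ) / (q : ℝ) ^ 2 +
          16 * (Fintype.card κ + Fintype.card ι * Fintype.card κ) * (τ * Real.log q) / q) := by
  refine (norm_coupledEpsW_le hw hab hab' hq hqk hqk' hτ0 ha ha').trans (le_of_eq ?_)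
  unfold badConstW
  ring

/-- `|η^w_p| ≤ 6^{k+k'} C^w₁/p²` at good primes (the shape of `norm_coupledEps_le_of_good`).
[cite: Maynard2016LargeGaps, §6 displays (6.12), (6.32)] -/
theorem norm_coupledEpsW_le_of_good' {w : ℕ → ℂ} (hw : IsLcmWeight w) {m : ℕ}
    {M : ℕ → Finset (ι × κ)} {a b : ι → ℂ} {a' b' : κ → ℂ} (hab : ∀ i, 0 ≤ (a i).re ∧ 0 ≤ (b i).re)
    (hab' : ∀ j, 0 ≤ (a' j).re ∧ 0 ≤ (b' j).re) {q : ℕ} (hq : q.Prime)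
    (hqk : 7 * Fintype.card ι ≤ q) (hqk' : 7 * Fintype.card κ ≤ q) (hqm : ¬ q ∣ m) (hM : M q = ∅) :
    ‖coupledEpsW w m M a b a' b' q‖ ≤
      6 ^ (Fintype.card ι + Fintype.card κ) *
        (goodConstW (Fintype.card ι) (Fintype.card κ) / (q : ℝ) ^ 2) := by
  refine (norm_coupledEpsW_le_of_good hw hab hab' hq hqk hqk' hqm hM).trans (le_of_eq ?_)
  unfold goodConstW
  ring

/-! ### Definitions -/

/-- `η'^w_n := η^w_n` at primes `n ∤ W`, `0` otherwise. [cite: Maynard2016LargeGaps, §6 displays (6.12)–(6.13)] -/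
def coupledEpsSeqW (w : ℕ → ℂ) (W m : ℕ) (M : ℕ → Finset (ι × κ)) (a b : ι → ℂ) (a' b' : κ → ℂ) (n : ℕ) : ℂ :=
  if n.Prime ∧ ¬ n ∣ W then coupledEpsW w m M a b a' b' n else 0

/-- **`E^w := ∏_{p ∤ W} (1 + η^w_p)`**, the `1 + o(1)` factor of (6.12)–(6.14) for the weighted kernel (6.32). [cite: Maynard2016LargeGaps, §6 display (6.14)] -/
def coupledEpsProdW (w : ℕ → ℂ) (W m : ℕ) (M : ℕ → Finset (ι × κ)) (a b : ι → ℂ) (a' b' : κ → ℂ) : ℂ :=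
  ∏' n : ℕ, (1 + coupledEpsSeqW w W m M a b a' b' n)

/-- The total `T^w = 6^{k+k'} (2 C^w₂/p₀ + 16(k'+kk') τ Σ_{p ∈ Bad} log p/p)` bounding `Σ_p |η^w_p|`.
[cite: Maynard2016LargeGaps, §6 display (6.14)] -/
def epsTotalW (k k' p₀ : ℕ) (τ : ℝ) (Bad : Finset ℕ) : ℝ :=
  6 ^ (k + k') * (2 * badConstW k k' / p₀ + 16 * (k' + k * k') * (τ * ∑ p ∈ Bad, Real.log p / p))

section Bounds

variable {w : ℕ → ℂ} (hw : IsLcmWeight w) {W m : ℕ} {M : ℕ → Finset (ι × κ)} {a b : ι → ℂ} {a' b' : κ → ℂ}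
  (hab : ∀ i, 0 ≤ (a i).re ∧ 0 ≤ (b i).re) (hab' : ∀ j, 0 ≤ (a' j).re ∧ 0 ≤ (b' j).re)
  {p₀ : ℕ} (hp₀ : 2 ≤ p₀) (hp₀k : 7 * Fintype.card ι ≤ p₀) (hp₀k' : 7 * Fintype.card κ ≤ p₀)
  (hWp : ∀ q : ℕ, q.Prime → ¬ q ∣ W → p₀ ≤ q)
  {τ : ℝ} (hτ0 : 0 ≤ τ) (ha : ∀ i, ‖a i‖ ≤ τ) (ha' : ∀ j, ‖a' j‖ ≤ τ)
  {Bad : Finset ℕ} (hBad : ∀ q : ℕ, q.Prime → ¬ q ∣ W → q ∉ Bad → ¬ q ∣ m ∧ M q = ∅)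


include hw hab hab' hp₀k hp₀k' hWp hτ0 ha ha' hBad in
/-- **Pointwise bound**: `|η'_n| ≤ [p₀ ≤ n] 6^{k+k'} C₂/n² + [n ∈ Bad] 6^{k+k'} 16(k'+kk') τ log n/n`.
[cite: Maynard2016LargeGaps, §6 displays (6.12)–(6.13)] -/
theorem norm_coupledEpsSeqW_le (n : ℕ) :
    ‖coupledEpsSeqW w W m M a b a' b' n‖ ≤
      (if p₀ ≤ n then 6 ^ (Fintype.card ι + Fintype.card κ) *
          (badConstW (Fintype.card ι) (Fintype.card κ) / (n : ℝ) ^ 2) else 0) +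
        (if n ∈ Bad then 6 ^ (Fintype.card ι + Fintype.card κ) *
          (16 * (Fintype.card κ + Fintype.card ι * Fintype.card κ) * (τ * Real.log n) / n) else 0) := by
  have hB := badConstW_nonneg (Fintype.card ι) (Fintype.card κ)
  have h2nd : 0 ≤ (if n ∈ Bad then 6 ^ (Fintype.card ι + Fintype.card κ) *
      (16 * (Fintype.card κ + Fintype.card ι * Fintype.card κ) * (τ * Real.log n) / n) else (0 : ℝ)) := by
    split_ifs
    · have : 0 ≤ Real.log n := by
        rcases Nat.eq_zero_or_pos n with h | h
        · simp [h]
        · exact Real.log_nonneg (by exact_mod_cast h)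
      positivity
    · exact le_rfl
  have h1st : 0 ≤ (if p₀ ≤ n then 6 ^ (Fintype.card ι + Fintype.card κ) *
      (badConstW (Fintype.card ι) (Fintype.card κ) / (n : ℝ) ^ 2) else (0 : ℝ)) := by
    split_ifs <;> positivity
  unfold coupledEpsSeqW
  by_cases hn : n.Prime ∧ ¬ n ∣ W
  · rw [if_pos hn]
    have hpn : p₀ ≤ n := hWp n hn.1 hn.2
    rw [if_pos hpn]
    have hnk : 7 * Fintype.card ι ≤ n := hp₀k.trans hpn
    have hnk' : 7 * Fintype.card κ ≤ n := hp₀k'.trans hpn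
    by_cases hnB : n ∈ Bad
    · rw [if_pos hnB, ← mul_add]
      exact norm_coupledEpsW_le' hw hab hab' hn.1 hnk hnk' hτ0 ha ha'
    · rw [if_neg hnB, add_zero]
      obtain ⟨hnm, hM⟩ := hBad n hn.1 hn.2 hnB
      refine (norm_coupledEpsW_le_of_good' hw hab hab' hn.1 hnk hnk' hnm hM).trans ?_
      gcongr
      exact goodConstW_le_badConstW _ _
  · rw [if_neg hn, norm_zero]
    exact add_nonneg h1st h2nd

include hw hab hab' hp₀ hp₀k hp₀k' hWp hτ0 ha ha' hBad in
/-- **Partial sums of `|η'_n|` are at most `T`** ("`∏_{p>w}(1+O(p^{-2})) · ∏_{bad}(1+O(…)) = exp(O(w^{-1} + …))`").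
[cite: Maynard2016LargeGaps, §6 display (6.14)] -/
theorem sum_norm_coupledEpsSeqW_le (s : Finset ℕ) :
    ∑ n ∈ s, ‖coupledEpsSeqW w W m M a b a' b' n‖ ≤
      epsTotalW (Fintype.card ι) (Fintype.card κ) p₀ τ Bad := by
  set k := Fintype.card ι
  set k' := Fintype.card κ
  set C : ℝ := 6 ^ (k + k') * badConstW k k'
  set D : ℝ := 6 ^ (k + k') * (16 * (k' + k * k') * τ)
  have hC : 0 ≤ C := by have := badConstW_nonneg k k'; positivity
  have hD : 0 ≤ D := by positivity
  have hlog : ∀ n : ℕ, 0 ≤ Real.log n := fun n => by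
    rcases Nat.eq_zero_or_pos n with h | h
    · simp [h]
    · exact Real.log_nonneg (by exact_mod_cast h)
  -- first part: `∑_{n ∈ s, p₀ ≤ n} C/n² ≤ 2C/p₀`
  set N := s.sup id + 1 with hN
  have hsub : s.filter (fun n => p₀ ≤ n) ⊆ Finset.Ioo (p₀ - 1) N := by
    intro n hn
    rw [Finset.mem_filter] at hn
    rw [Finset.mem_Ioo]
    have : n ≤ s.sup id := Finset.le_sup (f := id) hn.1
    omega
  have hA : ∑ n ∈ s, (if p₀ ≤ n then C / (n : ℝ) ^ 2 else 0) ≤ 2 * C / p₀ := by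
    calc ∑ n ∈ s, (if p₀ ≤ n then C / (n : ℝ) ^ 2 else 0)
        = ∑ n ∈ s.filter (fun n => p₀ ≤ n), C / (n : ℝ) ^ 2 := by rw [Finset.sum_filter]
      _ ≤ ∑ n ∈ Finset.Ioo (p₀ - 1) N, C / (n : ℝ) ^ 2 :=
          Finset.sum_le_sum_of_subset_of_nonneg hsub fun n _ _ => by positivity
      _ = C * ∑ n ∈ Finset.Ioo (p₀ - 1) N, ((n : ℝ) ^ 2)⁻¹ := by
          rw [Finset.mul_sum]; exact Finset.sum_congr rfl fun n _ => by rw [div_eq_mul_inv]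
      _ ≤ C * (2 / ((p₀ - 1 : ℕ) + 1)) := mul_le_mul_of_nonneg_left (sum_Ioo_inv_sq_le _ _) hC
      _ = 2 * C / p₀ := by
          have : ((p₀ - 1 : ℕ) : ℝ) + 1 = p₀ := by
            rw [Nat.cast_sub (by omega : 1 ≤ p₀)]; push_cast; ring
          rw [this]; ring
  -- second part: `∑_{n ∈ s ∩ Bad} D log n/n ≤ D ∑_{p ∈ Bad} log p/p`
  have hBsum : ∑ n ∈ s, (if n ∈ Bad then D * Real.log n / n else 0) ≤
      D * ∑ p ∈ Bad, Real.log p / p := by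
    rw [← Finset.sum_filter]
    have hsub' : s.filter (fun n => n ∈ Bad) ⊆ Bad := fun n hn => (Finset.mem_filter.1 hn).2
    calc ∑ n ∈ s.filter (fun n => n ∈ Bad), D * Real.log n / n
        ≤ ∑ n ∈ Bad, D * Real.log n / n := Finset.sum_le_sum_of_subset_of_nonneg hsub'
          fun n _ _ => div_nonneg (mul_nonneg hD (hlog n)) (Nat.cast_nonneg n)
      _ = D * ∑ p ∈ Bad, Real.log p / p := by
          rw [Finset.mul_sum]; exact Finset.sum_congr rfl fun n _ => by ring
  calc ∑ n ∈ s, ‖coupledEpsSeqW w W m M a b a' b' n‖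
      ≤ ∑ n ∈ s, ((if p₀ ≤ n then C / (n : ℝ) ^ 2 else 0) +
          (if n ∈ Bad then D * Real.log n / n else 0)) := by
        refine Finset.sum_le_sum fun n _ => (norm_coupledEpsSeqW_le hw hab hab' hp₀k hp₀k' hWp hτ0 ha ha' hBad n).trans (le_of_eq ?_)
        congr 1
        · split_ifs <;> ring
        · split_ifs <;> ring
    _ = (∑ n ∈ s, (if p₀ ≤ n then C / (n : ℝ) ^ 2 else 0)) +
          ∑ n ∈ s, (if n ∈ Bad then D * Real.log n / n else 0) := Finset.sum_add_distrib
    _ ≤ 2 * C / p₀ + D * ∑ p ∈ Bad, Real.log p / p := add_le_add hA hBsum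
    _ = epsTotalW k k' p₀ τ Bad := by simp only [epsTotalW, C, D]; ring

include hw hab hab' hp₀ hp₀k hp₀k' hWp hτ0 ha ha' hBad in
/-- `∑ |η'_n| < ∞`. [cite: Maynard2016LargeGaps, §6 display (6.14)] -/
theorem summable_norm_coupledEpsSeqW : Summable fun n => ‖coupledEpsSeqW w W m M a b a' b' n‖ :=
  summable_of_sum_le (fun _ => norm_nonneg _)
    (sum_norm_coupledEpsSeqW_le hw hab hab' hp₀ hp₀k hp₀k' hWp hτ0 ha ha' hBad)

include hw hab hab' hp₀ hp₀k hp₀k' hWp hτ0 ha ha' hBad in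
/-- The partial products `∏_{p < N, p ∤ W} (1 + η_p)` tend to `E`. [cite: Maynard2016LargeGaps, §6 display (6.14)] -/
theorem tendsto_prod_one_add_coupledEpsW :
    Tendsto (fun N : ℕ => ∏ q ∈ primesBelowNotDvd W N, (1 + coupledEpsW w m M a b a' b' q)) atTop
      (𝓝 (coupledEpsProdW w W m M a b a' b')) := by
  have hmul : Multipliable fun n => 1 + coupledEpsSeqW w W m M a b a' b' n :=
    Complex.multipliable_one_add_of_summable
      (summable_norm_coupledEpsSeqW hw hab hab' hp₀ hp₀k hp₀k' hWp hτ0 ha ha' hBad).of_norm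
  have h := hmul.hasProd.tendsto_prod_nat
  refine h.congr fun N => ?_
  rw [primesBelowNotDvd, Nat.primesBelow, Finset.filter_filter, Finset.prod_filter]
  refine Finset.prod_congr rfl fun n _ => ?_
  unfold coupledEpsSeqW
  split_ifs <;> simp

include hw hab hab' hp₀ hp₀k hp₀k' hWp hτ0 ha ha' hBad in
/-- `‖∏_{p < N, p ∤ W} (1 + η_p)‖ ≤ exp(T)`. [cite: Maynard2016LargeGaps, §6 display (6.14)] -/
theorem norm_prod_one_add_coupledEpsW_le (N : ℕ) :
    ‖∏ q ∈ primesBelowNotDvd W N, (1 + coupledEpsW w m M a b a' b' q)‖ ≤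
      Real.exp (epsTotalW (Fintype.card ι) (Fintype.card κ) p₀ τ Bad) := by
  refine (norm_prod_one_add_le_exp _ _).trans (Real.exp_le_exp.2 ?_)
  have h := sum_norm_coupledEpsSeqW_le hw hab hab' hp₀ hp₀k hp₀k' hWp hτ0 ha ha' hBad (primesBelowNotDvd W N)
  refine le_trans (le_of_eq ?_) h
  refine Finset.sum_congr rfl fun q hq => ?_
  rw [coupledEpsSeqW, if_pos ⟨prime_of_mem_primesBelowNotDvd hq, not_dvd_of_mem_primesBelowNotDvd hq⟩]

include hw hab hab' hp₀ hp₀k hp₀k' hWp hτ0 ha ha' hBad in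
/-- `‖∏_{p < N, p ∤ W} (1 + η_p) − 1‖ ≤ exp(T) − 1`. [cite: Maynard2016LargeGaps, §6 display (6.14)] -/
theorem norm_prod_one_add_coupledEpsW_sub_one_le (N : ℕ) :
    ‖∏ q ∈ primesBelowNotDvd W N, (1 + coupledEpsW w m M a b a' b' q) - 1‖ ≤
      Real.exp (epsTotalW (Fintype.card ι) (Fintype.card κ) p₀ τ Bad) - 1 := by
  refine (Finset.norm_prod_one_add_sub_one_le _ _).trans ?_
  have h := sum_norm_coupledEpsSeqW_le hw hab hab' hp₀ hp₀k hp₀k' hWp hτ0 ha ha' hBad (primesBelowNotDvd W N)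
  have h' : ∑ q ∈ primesBelowNotDvd W N, ‖coupledEpsW w m M a b a' b' q‖ =
      ∑ q ∈ primesBelowNotDvd W N, ‖coupledEpsSeqW w W m M a b a' b' q‖ :=
    Finset.sum_congr rfl fun q hq => by
      rw [coupledEpsSeqW, if_pos ⟨prime_of_mem_primesBelowNotDvd hq, not_dvd_of_mem_primesBelowNotDvd hq⟩]
  rw [h']
  linarith [Real.exp_le_exp.2 h]

include hw hab hab' hp₀ hp₀k hp₀k' hWp hτ0 ha ha' hBad in
/-- **`‖E‖ ≤ exp(T)`**. [cite: Maynard2016LargeGaps, §6 display (6.14)] -/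
theorem norm_coupledEpsProdW_le :
    ‖coupledEpsProdW w W m M a b a' b'‖ ≤ Real.exp (epsTotalW (Fintype.card ι) (Fintype.card κ) p₀ τ Bad) :=
  le_of_tendsto' ((continuous_norm.tendsto _).comp
    (tendsto_prod_one_add_coupledEpsW hw hab hab' hp₀ hp₀k hp₀k' hWp hτ0 ha ha' hBad))
    fun N => norm_prod_one_add_coupledEpsW_le hw hab hab' hp₀ hp₀k hp₀k' hWp hτ0 ha ha' hBad N

include hw hab hab' hp₀ hp₀k hp₀k' hWp hτ0 ha ha' hBad in
/-- **`‖E − 1‖ ≤ exp(T) − 1`** — (6.14): `E = 1 + o(1)` as soon as `T → 0`.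
[cite: Maynard2016LargeGaps, §6 display (6.14)] -/
theorem norm_coupledEpsProdW_sub_one_le :
    ‖coupledEpsProdW w W m M a b a' b' - 1‖ ≤
      Real.exp (epsTotalW (Fintype.card ι) (Fintype.card κ) p₀ τ Bad) - 1 :=
  le_of_tendsto' ((continuous_norm.tendsto _).comp
    ((tendsto_prod_one_add_coupledEpsW hw hab hab' hp₀ hp₀k hp₀k' hWp hτ0 ha ha' hBad).sub_const 1))
    fun N => norm_prod_one_add_coupledEpsW_sub_one_le hw hab hab' hp₀ hp₀k hp₀k' hWp hτ0 ha ha' hBad N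

end Bounds

/-! ### `K = E · N · Z(s,s') · Z(r,r')` -/

/-- **The coupled kernel against `ζ`** ((6.11)–(6.16)): for `W ≠ 0`, exponents of real part `≥ σ > 0`
and norm `≤ τ`, every prime `∤ W` at least `p₀ ≥ 7k, 7k'`, and a finite set `Bad` outside which
`p ∤ m` and `M_p = ∅`:
`K = E · N · ∏_ℓ ζ_W(1+s_ℓ+s'_ℓ)/(ζ_W(1+s_ℓ)ζ_W(1+s'_ℓ)) · ∏_ℓ ζ_W(1+r_ℓ+r'_ℓ)/(ζ_W(1+r_ℓ)ζ_W(1+r'_ℓ))`.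
[cite: Maynard2016LargeGaps, §6 display (6.16)] -/
theorem coupledKernelW_eq_prod {w : ℕ → ℂ} (hw : IsLcmWeight w) {W m : ℕ} (hW : W ≠ 0) (M : ℕ → Finset (ι × κ)) {a b : ι → ℂ}
    {a' b' : κ → ℂ} {σ : ℝ} (hσ : 0 < σ) (habσ : ∀ i, σ ≤ (a i).re ∧ σ ≤ (b i).re)
    (hab'σ : ∀ j, σ ≤ (a' j).re ∧ σ ≤ (b' j).re) {p₀ : ℕ} (hp₀ : 2 ≤ p₀)
    (hp₀k : 7 * Fintype.card ι ≤ p₀) (hp₀k' : 7 * Fintype.card κ ≤ p₀)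
    (hWp : ∀ q : ℕ, q.Prime → ¬ q ∣ W → p₀ ≤ q) {τ : ℝ} (hτ0 : 0 ≤ τ) (ha : ∀ i, ‖a i‖ ≤ τ)
    (ha' : ∀ j, ‖a' j‖ ≤ τ) {Bad : Finset ℕ}
    (hBad : ∀ q : ℕ, q.Prime → ¬ q ∣ W → q ∉ Bad → ¬ q ∣ m ∧ M q = ∅) :
    coupledKernelW w W m M a b a' b' =
      coupledEpsProdW w W m M a b a' b' * nuProd W m M Bad * (zetaLimit W a b * zetaLimit W a' b') := by
  have hab : ∀ i, 0 ≤ (a i).re ∧ 0 ≤ (b i).re := fun i =>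
    ⟨hσ.le.trans (habσ i).1, hσ.le.trans (habσ i).2⟩
  have hab' : ∀ j, 0 ≤ (a' j).re ∧ 0 ≤ (b' j).re := fun j =>
    ⟨hσ.le.trans (hab'σ j).1, hσ.le.trans (hab'σ j).2⟩
  have habp : ∀ i, 0 < (a i).re ∧ 0 < (b i).re := fun i =>
    ⟨hσ.trans_le (habσ i).1, hσ.trans_le (habσ i).2⟩
  have hab'p : ∀ j, 0 < (a' j).re ∧ 0 < (b' j).re := fun j =>
    ⟨hσ.trans_le (hab'σ j).1, hσ.trans_le (hab'σ j).2⟩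
  have h1 := tendsto_prod_coupledLocalFactorMuW hw (W := W) (m := m) M hσ habσ hab'σ
  have heq : (fun N : ℕ => ∏ q ∈ primesBelowNotDvd W N, coupledLocalFactorMuW w m M a b a' b' q) =
      fun N => (∏ q ∈ primesBelowNotDvd W N, (1 + coupledEpsW w m M a b a' b' q)) *
        (∏ q ∈ primesBelowNotDvd W N, (1 + (coupledNu m M q : ℂ) / q)) *
        ((∏ q ∈ primesBelowNotDvd W N, zetaFactor a b q) *
          ∏ q ∈ primesBelowNotDvd W N, zetaFactor a' b' q) := by
    funext N
    rw [← Finset.prod_mul_distrib, ← Finset.prod_mul_distrib, ← Finset.prod_mul_distrib]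
    exact Finset.prod_congr rfl fun q hq => by
      rw [coupledLocalFactorMuW_eq_mul w hab hab' (prime_of_mem_primesBelowNotDvd hq).two_le]; ring
  rw [heq] at h1
  have hE := tendsto_prod_one_add_coupledEpsW hw hab hab' hp₀ hp₀k hp₀k' hWp hτ0 ha ha' hBad
  have hN : Tendsto (fun N : ℕ => ∏ q ∈ primesBelowNotDvd W N, (1 + (coupledNu m M q : ℂ) / q))
      atTop (𝓝 (nuProd W m M Bad)) := by
    refine tendsto_const_nhds.congr' ?_
    filter_upwards [eventually_gt_atTop (Bad.sup id)] with N hN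
    exact (prod_one_add_coupledNu_div_eq hBad fun q hq =>
      lt_of_le_of_lt (Finset.le_sup (f := id) hq) hN).symm
  have hZ := tendsto_prod_zetaFactor hW habp
  have hZ' := tendsto_prod_zetaFactor hW hab'p
  exact tendsto_nhds_unique h1 ((hE.mul hN).mul (hZ.mul hZ'))

end LcmEuler

end Literature.NumberTheory.Sieve

end
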